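import Mathlib
import HarnessLib

/-!
# THETA certificate, tier 2, E5-bridge: the LOG-CELL STEP MAJORANT built from a non-increasing hull sequence (RH-FREE real analysis)

Cell `rh-explicit`, WEIL column, seat weil-1 gen20 (cc-s2-1 gen22 TIER2-KERNEL-SPEC §2 «Cross term», (K4)). The kernel exports a
NON-INCREASING nonnegative hull sequence `Gs : ℕ → ℝ` on the lag cells `log(x/N) ∈ [kτ, (k+1)τ)` and the Riemann-type sum
`integ ≥ Σ_{k<K} Gs_k·(e^{(k+1)τ} − e^{kτ})`. To feed the partial-summation lemma E5 (`ThetaPrime.sum_Ioc_vonMangoldt_mul_le_of_antitoneOn`,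
which wants an ANTITONE real majorant `F` on `[N, ∞)` and produces `C·(N·F(N) + ∫_N^b F)`), this file studies the step function
`F(x) = Gs ⌊log(x/N)/τ⌋₊ / √N` WITHOUT naming it (no definitions): it is nonnegative and antitone on `[N, ∞)`, equals `Gs k/√N` at the
left end `x = N·e^{kτ}` of lag cell `k` and is `≤ Gs k/√N` on the closed cell, `N·F(N) = √N·Gs 0`, and
`∫_N^{N e^{Kτ}} F ≤ √N·Σ_{k<K} Gs k·(e^{(k+1)τ} − e^{kτ})`. Nothing here bears on the truth of RH.
-/

noncomputable section

set_option linter.dupNamespace false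

open MeasureTheory Set Real

namespace Summit.RiemannHypothesis.RiemannHypothesis.Theorems.WeilColumn.ThetaPrime

variable {N τ : ℝ} {Gs : ℕ → ℝ}

/-- The lag-cell index `⌊log(x/N)/τ⌋₊` is monotone in `x ≥ N`. [folklore] -/
theorem lagCell_mono (hN : 0 < N) (hτ : 0 < τ) {x y : ℝ} (hx : N ≤ x) (hxy : x ≤ y) :
    ⌊Real.log (x / N) / τ⌋₊ ≤ ⌊Real.log (y / N) / τ⌋₊ := by
  refine Nat.floor_le_floor (div_le_div_of_nonneg_right ?_ hτ.le)
  exact Real.log_le_log (div_pos (hN.trans_le hx) hN) (div_le_div_of_nonneg_right hxy hN.le)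

/-- On the closed lag cell `k` (`N e^{kτ} ≤ x ≤ N e^{(k+1)τ}`) the index is `k` or `k+1`. [folklore] -/
theorem lagCell_mem (hN : 0 < N) (hτ : 0 < τ) {k : ℕ} {x : ℝ} (h1 : N * Real.exp (k * τ) ≤ x) (h2 : x ≤ N * Real.exp ((k + 1) * τ)) :
    k ≤ ⌊Real.log (x / N) / τ⌋₊ ∧ ⌊Real.log (x / N) / τ⌋₊ ≤ k + 1 := by
  have hx : 0 < x := lt_of_lt_of_le (by positivity) h1
  have hlo : (k : ℝ) * τ ≤ Real.log (x / N) := by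
    rw [Real.le_log_iff_exp_le (div_pos hx hN), le_div_iff₀ hN]; linarith
  have hhi : Real.log (x / N) ≤ ((k : ℝ) + 1) * τ := by
    rw [Real.log_le_iff_le_exp (div_pos hx hN), div_le_iff₀ hN]; linarith
  constructor
  · exact Nat.le_floor (by rw [le_div_iff₀ hτ]; exact hlo)
  · have : Real.log (x / N) / τ ≤ (k : ℝ) + 1 := by rw [div_le_iff₀ hτ]; exact hhi
    have h := Nat.floor_le_floor this
    have e : ⌊((k : ℝ) + 1)⌋₊ = k + 1 := by exact_mod_cast Nat.floor_natCast (k + 1)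
    rwa [e] at h

/-- **The step majorant is antitone on `[N, ∞)`** when `Gs` is non-increasing. [folklore] -/
theorem stepMajorant_antitoneOn (hN : 0 < N) (hτ : 0 < τ) (hGs : ∀ k, Gs (k + 1) ≤ Gs k) :
    AntitoneOn (fun x : ℝ ↦ Gs ⌊Real.log (x / N) / τ⌋₊ / Real.sqrt N) (Set.Ici N) := by
  have hanti : Antitone Gs := antitone_nat_of_succ_le hGs
  intro x hx y _ hxy
  exact div_le_div_of_nonneg_right (hanti (lagCell_mono hN hτ hx hxy)) (Real.sqrt_nonneg _)

/-- The step majorant is nonnegative when `Gs` is. [folklore] -/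
theorem stepMajorant_nonneg (hGs0 : ∀ k, 0 ≤ Gs k) (x : ℝ) :
    0 ≤ Gs ⌊Real.log (x / N) / τ⌋₊ / Real.sqrt N :=
  div_nonneg (hGs0 _) (Real.sqrt_nonneg _)

/-- At `x = N`: `N·F(N) = √N·Gs 0`. [folklore] -/
theorem stepMajorant_boundary (hN : 0 < N) :
    N * (Gs ⌊Real.log (N / N) / τ⌋₊ / Real.sqrt N) = Real.sqrt N * Gs 0 := by
  rw [div_self hN.ne', Real.log_one, zero_div, Nat.floor_zero,
    show N * (Gs 0 / Real.sqrt N) = N / Real.sqrt N * Gs 0 by ring, Real.div_sqrt]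

/-- On the closed lag cell `k` the step majorant is at most `Gs k/√N` (the right endpoint carries `Gs (k+1) ≤ Gs k`). [folklore] -/
theorem stepMajorant_le_on_cell (hN : 0 < N) (hτ : 0 < τ) (hGs : ∀ k, Gs (k + 1) ≤ Gs k) {k : ℕ} {x : ℝ}
    (h1 : N * Real.exp (k * τ) ≤ x) (h2 : x ≤ N * Real.exp ((k + 1) * τ)) :
    Gs ⌊Real.log (x / N) / τ⌋₊ / Real.sqrt N ≤ Gs k / Real.sqrt N := by
  have hanti : Antitone Gs := antitone_nat_of_succ_le hGs
  exact div_le_div_of_nonneg_right (hanti (lagCell_mem hN hτ h1 h2).1) (Real.sqrt_nonneg _)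

/-- **The integral of the step majorant over the first `K` lag cells**:
`∫_N^{N e^{Kτ}} F ≤ √N·Σ_{k<K} Gs k·(e^{(k+1)τ} − e^{kτ})` (the kernel's `integ`). [TIER2-KERNEL-SPEC §2 E5; folklore] -/
theorem integral_stepMajorant_le (hN : 0 < N) (hτ : 0 < τ) (hGs : ∀ k, Gs (k + 1) ≤ Gs k) (K : ℕ) :
    ∫ x in N..N * Real.exp (K * τ), Gs ⌊Real.log (x / N) / τ⌋₊ / Real.sqrt N ≤
      Real.sqrt N * ∑ k ∈ Finset.range K, Gs k * (Real.exp ((k + 1) * τ) - Real.exp (k * τ)) := by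
  set F : ℝ → ℝ := fun x ↦ Gs ⌊Real.log (x / N) / τ⌋₊ / Real.sqrt N with hF
  set a : ℕ → ℝ := fun k ↦ N * Real.exp (k * τ) with ha
  have hmono_a : Monotone a := fun i j hij ↦ by
    simp only [ha]
    exact mul_le_mul_of_nonneg_left (Real.exp_le_exp.2 (mul_le_mul_of_nonneg_right (by exact_mod_cast hij) hτ.le)) hN.le
  have ha0 : a 0 = N := by simp [ha]
  have hanti : AntitoneOn F (Set.Ici N) := stepMajorant_antitoneOn hN hτ hGs
  -- `F` is interval integrable on every `[a i, a (i+1)]` (antitone on `[N, ∞)`)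
  have hint : ∀ i : ℕ, IntervalIntegrable F volume (a i) (a (i + 1)) := fun i ↦ by
    refine (hanti.mono fun x hx ↦ ?_).intervalIntegrable
    rw [Set.uIcc_of_le (hmono_a (Nat.le_succ i)), Set.mem_Icc] at hx
    exact le_trans (by rw [← ha0]; exact hmono_a (Nat.zero_le i)) hx.1
  -- split the integral at the cell boundaries
  have hsplit : ∫ x in a 0..a K, F x = ∑ k ∈ Finset.range K, ∫ x in a k..a (k + 1), F x :=
    (intervalIntegral.sum_integral_adjacent_intervals fun k _ ↦ hint k).symm
  rw [ha0] at hsplit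
  rw [show (∫ x in N..N * Real.exp (K * τ), Gs ⌊Real.log (x / N) / τ⌋₊ / Real.sqrt N) = ∫ x in N..a K, F x from rfl,
    hsplit, Finset.mul_sum]
  refine Finset.sum_le_sum fun k _ ↦ ?_
  -- on cell `k`: `F ≤ Gs k/√N`, a constant
  have hle : ∀ x ∈ Set.Icc (a k) (a (k + 1)), F x ≤ Gs k / Real.sqrt N := fun x hx ↦
    stepMajorant_le_on_cell hN hτ hGs (k := k) hx.1 (by simpa [ha, Nat.cast_add, Nat.cast_one] using hx.2)
  have hk : a k ≤ a (k + 1) := hmono_a (Nat.le_succ k)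
  calc ∫ x in a k..a (k + 1), F x ≤ ∫ x in a k..a (k + 1), Gs k / Real.sqrt N :=
        intervalIntegral.integral_mono_on hk (hint k) intervalIntegrable_const hle
    _ = (a (k + 1) - a k) * (Gs k / Real.sqrt N) := by rw [intervalIntegral.integral_const, smul_eq_mul]
    _ = Real.sqrt N * (Gs k * (Real.exp ((k + 1) * τ) - Real.exp (k * τ))) := by
        simp only [ha, Nat.cast_add, Nat.cast_one]
        rw [show (N * Real.exp (((k : ℝ) + 1) * τ) - N * Real.exp ((k : ℝ) * τ)) * (Gs k / Real.sqrt N) =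
          N / Real.sqrt N * (Gs k * (Real.exp (((k : ℝ) + 1) * τ) - Real.exp ((k : ℝ) * τ))) by ring, Real.div_sqrt]

end Summit.RiemannHypothesis.RiemannHypothesis.Theorems.WeilColumn.ThetaPrime

end
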